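import Summits.CriticalPhenomena.PercolationContinuityZ3.Theorems.PercExchangeRateTransportModelFacts
import HarnessLib

/-!
# Stub `stub_partialsContinuous` of the crux `SupercritExchangeUniformity` (K⁺), line
# `local_exchange_homogeneity` (stmt-CriticalPhenomena-16061): joint continuity of `∂_tΘ_n`, `∂_pΘ_n`

This file proves the REGISTERED stub verbatim (skeleton
`Cruxes/SupercritExchangeUniformity/Lines/local_exchange_homogeneity.lean`): for the label-coupled
anisotropic bond family on `ℤ²×ℤ` (route `let` preamble `μ, vert, cfg, Θ`;
`Θ n p t = μ(cfg p t ∈ {0 ↔ ∂Λ_n in Λ_n})`), for every `n` both one-variable partial derivatives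
`(p,t) ↦ deriv (Θ n p ·) t` and `(p,t) ↦ deriv (Θ n · t) p` are continuous on the open unit
square `(0,1)²`.

Argument (pure calculus on clause (2) of the landed route item `ModelFacts`,
`…Theorems.ModelFacts.modelFacts_proof`: `(p,t) ↦ Θ n p t` is `C¹` on the open square — there
`Θ_n` is a polynomial, Grimmett 1999 §2.4): on an open set `U ⊆ ℝ²` a `C¹` function `F` has a
continuous Fréchet derivative (`ContDiffOn.continuousOn_fderiv_of_isOpen`), its one-variable
slices `s ↦ F (p,s)`, `q ↦ F (q,t)` have derivatives `DF(p,t)(0,1)`, `DF(p,t)(1,0)` (chain rule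
`HasFDerivAt.comp_hasDerivAt` along `s ↦ (p,s)`, `q ↦ (q,t)`), and `x ↦ DF(x) v` is continuous on
`U` (`ContinuousOn.clm_apply`); conclude by `ContinuousOn.congr`. The generic two-variable lemma is
`PartialsContinuous.continuousOn_partials_of_contDiffOn` (cf. the tree's
`Literature.Analysis.Calculus.exists_partials_of_contDiff_two`, the global `C²` version).

The theorem header is one long line: the gate matches registered stub signatures against the
verbatim header text (`;`-separated `let`s).
-/

noncomputable section

open MeasureTheory
open Literature.Probability.Percolation Literature.Probability.LatticeModels

namespace Summit.CriticalPhenomena.PercolationContinuityZ3.Theorems.SupercritExchangeUniformity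

namespace PartialsContinuous

/-- Chain rule along the vertical line `s ↦ (p, s)`: the slice `s ↦ F (p, s)` of a function
differentiable at `(p, t)` has derivative `DF(p,t)(0,1)` at `t`. [folklore] -/
theorem hasDerivAt_slice_snd {F : ℝ × ℝ → ℝ} {p t : ℝ} (hF : DifferentiableAt ℝ F (p, t)) :
    HasDerivAt (fun s : ℝ => F (p, s)) (fderiv ℝ F (p, t) ((0 : ℝ), (1 : ℝ))) t :=
  hF.hasFDerivAt.comp_hasDerivAt t ((hasDerivAt_const t p).prodMk (hasDerivAt_id t))

/-- Chain rule along the horizontal line `q ↦ (q, t)`: the slice `q ↦ F (q, t)` of a function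
differentiable at `(p, t)` has derivative `DF(p,t)(1,0)` at `p`. [folklore] -/
theorem hasDerivAt_slice_fst {F : ℝ × ℝ → ℝ} {p t : ℝ} (hF : DifferentiableAt ℝ F (p, t)) :
    HasDerivAt (fun q : ℝ => F (q, t)) (fderiv ℝ F (p, t) ((1 : ℝ), (0 : ℝ))) p :=
  hF.hasFDerivAt.comp_hasDerivAt p ((hasDerivAt_id p).prodMk (hasDerivAt_const p t))

/-- **Partial derivatives of a `C¹` function of two real variables are jointly continuous** on an
open set `U`: both `(p,t) ↦ deriv (F (p, ·)) t` and `(p,t) ↦ deriv (F (·, t)) p` are continuous on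
`U` (they are the values of the continuous `fderiv ℝ F` on the coordinate vectors). [folklore] -/
theorem continuousOn_partials_of_contDiffOn {F : ℝ × ℝ → ℝ} {U : Set (ℝ × ℝ)} (hU : IsOpen U)
    (hC : ContDiffOn ℝ 1 F U) :
    ContinuousOn (fun x : ℝ × ℝ => deriv (fun s => F (x.1, s)) x.2) U ∧
      ContinuousOn (fun x : ℝ × ℝ => deriv (fun q => F (q, x.2)) x.1) U := by
  have hd : ∀ x ∈ U, DifferentiableAt ℝ F x := fun x hx =>
    (hC.differentiableOn one_ne_zero x hx).differentiableAt (hU.mem_nhds hx)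
  have hcf : ContinuousOn (fderiv ℝ F) U := hC.continuousOn_fderiv_of_isOpen hU le_rfl
  refine ⟨(hcf.clm_apply (continuousOn_const (c := ((0 : ℝ), (1 : ℝ))))).congr ?_,
    (hcf.clm_apply (continuousOn_const (c := ((1 : ℝ), (0 : ℝ))))).congr ?_⟩
  · rintro ⟨p, t⟩ hx
    exact (hasDerivAt_slice_snd (hd (p, t) hx)).deriv
  · rintro ⟨p, t⟩ hx
    exact (hasDerivAt_slice_fst (hd (p, t) hx)).deriv

end PartialsContinuous

open PartialsContinuous in
/-- **STUB `partialsContinuous`** (line `local_exchange_homogeneity` of the crux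
`SupercritExchangeUniformity`, K⁺). For the label-coupled anisotropic bond family on `ℤ²×ℤ` and
every `n`, the partial derivatives `(p,t) ↦ ∂_tΘ_n(p,t)` and `(p,t) ↦ ∂_pΘ_n(p,t)` (one-variable
`deriv`s of the slices) are continuous on the open unit square. Proof: clause (2) of the landed
route item `ModelFacts` (`modelFacts_proof`: `Θ_n` is `C¹` on the open square, a polynomial in
`(p,t)` — Grimmett 1999 §2.4) and the calculus lemma
`PartialsContinuous.continuousOn_partials_of_contDiffOn`. [Grimmett1999 §2.4] -/
theorem stub_partialsContinuous : let μ := Literature.Probability.Percolation.labelMeasure (Literature.Probability.LatticeModels.Site 3); let vert : Sym2 (Literature.Probability.LatticeModels.Site 3) → Prop := fun e => ∃ x : Literature.Probability.LatticeModels.Site 3, e = s(x, x + Pi.single (2 : Fin 3) 1); let cfg : ℝ → ℝ → (Sym2 (Literature.Probability.LatticeModels.Site 3) → ℝ) → Set (Sym2 (Literature.Probability.LatticeModels.Site 3)) := fun p t U => {e | e ∈ (Literature.Probability.LatticeModels.zdGraph 3).edgeSet ∧ ((vert e ∧ U e ≤ t) ∨ (¬ vert e ∧ U e ≤ p))}; let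 Θ : ℕ → ℝ → ℝ → ℝ := fun n p t => μ.real {U | cfg p t U ∈ Literature.Probability.Percolation.siteToBoundary 3 n}; ∀ n : ℕ, ContinuousOn (fun x : ℝ × ℝ => deriv (fun s => Θ n x.1 s) x.2) (Set.Ioo (0 : ℝ) 1 ×ˢ Set.Ioo (0 : ℝ) 1) ∧ ContinuousOn (fun x : ℝ × ℝ => deriv (fun q => Θ n q x.2) x.1) (Set.Ioo (0 : ℝ) 1 ×ˢ Set.Ioo (0 : ℝ) 1) := by
  intro μ vert cfg Θ n
  have hMF := Summit.CriticalPhenomena.PercolationContinuityZ3.Theorems.ModelFacts.modelFacts_proof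
  have h2 : ContDiffOn ℝ 1 (fun x : ℝ × ℝ => Θ n x.1 x.2) (Set.Ioo (0 : ℝ) 1 ×ˢ Set.Ioo (0 : ℝ) 1) :=
    hMF.2.1 n
  exact continuousOn_partials_of_contDiffOn (F := fun x : ℝ × ℝ => Θ n x.1 x.2)
    (isOpen_Ioo.prod isOpen_Ioo) h2

end Summit.CriticalPhenomena.PercolationContinuityZ3.Theorems.SupercritExchangeUniformity

end
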